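import Summits.AtomisticToContinuum.BoseEinsteinCondensation.Theorems.BECThomsonPrincipleFibreConductanceFlatteningDefs
import HarnessLib

/-!
# Route `BECThomsonPrinciple`, crux `FibreConductance` (stmt-AtomisticToContinuum-9480),
# line `parseval-shell-bootstrap` (r4) — stub `stub_lineFubini`: LINE FUBINI ON THE FIBRE CELL
# and the constancy `⟨⟨⟨g⟩₂⟩₁⟩₀ ≡ 1`

`stub_lineFubini : Goal.stub_lineFubini` (`= LineFubini ∧ Avg3Const` of
`Theorems/BECThomsonPrincipleFibreConductanceFlatteningDefs.lean`), the two Fubini facts consumed by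
the composition `densityFlatteningCubic_of` of the flattening chain.

* `lintegral_pi_eq_of_lintegral_update_eq` — Tonelli along ONE coordinate of a finite product
  (`lmarginal_erase'`): two measurable functions whose integrals along the `l`-th coordinate agree,
  as functions of the other coordinates, have equal integrals; `setLIntegral_cell_eq_of_line` — the
  same on the cell `[0,L)³ ⊂ ℝ³` through the volume-preserving chart `toLp : (Fin 3 → ℝ) → ℝ³`
  (pattern of `lintegral_cell_comp_coord0` in `FibreConductance/Negative/OneDimAxis`);
* `linePt_update_toLp`, `lineAvg_update_toLp` — the fibre line along the axis `l` through
  `X[0 ↦ z]` is `s ↦ X[0 ↦ z[l ↦ s]]`, so the line average at `X[0 ↦ z[l ↦ t]]` is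
  `L⁻¹∫₀ᴸ f(X[0 ↦ z[l ↦ s]]) ds`, independent of `t`;
* `lintegral_cell_ofReal_lineAvg` = `LineFubini`: both line integrals over `[0,L)` equal
  `ofReal (∫₀ᴸ f(X[0 ↦ z[l ↦ s]]) ds)` (the constant one by `|[0,L)| · L⁻¹ = 1`, the other by
  `ofReal_integral_eq_lintegral_ofReal` for the continuous nonnegative integrand);
* `gAvg3_update` — `⟨⟨⟨g⟩⟩⟩` is constant on every fibre (a line average is constant along its own line,
  `lineAvg_add_smul`, and inherits transverse invariances of its integrand,
  `lineAvg_add_of_apply_eq_zero`; `X[0 ↦ y]` is a translate of `X` along the three axes);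
* `gAvg3_eq_one` = `Avg3Const`: `L³·⟨⟨⟨g⟩⟩⟩(X) = ∫_cell ⟨⟨⟨g⟩⟩⟩ = ∫_cell ⟨⟨g⟩⟩ = ∫_cell ⟨g⟩ = ∫_cell g
  = L³ ∫_cell ψ² = L³` (`LineFubini` three times, `integral_fibrePsi_sq`), and cancel `L³`.

All [folklore] (Fubini–Tonelli and one-variable calculus; G. B. Folland, *Real Analysis* (1999),
Thm. 2.37, §2.5–2.6).
-/

noncomputable section

namespace Summit.AtomisticToContinuum.BoseEinsteinCondensation.Cruxes.FibreConductance.ParsevalShellBootstrap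

open MeasureTheory
open scoped ENNReal
open Literature.MathematicalPhysics.QuantumManyBody.BoseGas
open Summit.AtomisticToContinuum.BoseEinsteinCondensation.Cruxes.FibreConductance.TaggedPathHarnack

variable {m : ℕ} {L : ℝ}

/-! ### Tonelli along one coordinate, on `ℝ³` and on the cell -/

/-- **Tonelli along one coordinate of a finite product.** Two measurable functions on `Fin 3 → ℝ`
whose integrals along the `l`-th coordinate agree, as functions of the remaining coordinates, have
the same integral for the product measure (`∫ = ∫_{others} ∫_l`, `lmarginal_erase'`). [folklore] -/
theorem lintegral_pi_eq_of_lintegral_update_eq {μ : Fin 3 → Measure ℝ} [∀ i, SigmaFinite (μ i)]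
    (l : Fin 3) {F G : (Fin 3 → ℝ) → ℝ≥0∞} (hF : Measurable F) (hG : Measurable G)
    (h : ∀ z : Fin 3 → ℝ,
      ∫⁻ t, F (Function.update z l t) ∂μ l = ∫⁻ t, G (Function.update z l t) ∂μ l) :
    ∫⁻ w, F w ∂Measure.pi μ = ∫⁻ w, G w ∂Measure.pi μ := by
  have hFG : (fun z : Fin 3 → ℝ => ∫⁻ t, F (Function.update z l t) ∂μ l) =
      fun z => ∫⁻ t, G (Function.update z l t) ∂μ l := funext h
  rw [lintegral_eq_lmarginal_univ (fun _ => (0 : ℝ)), lintegral_eq_lmarginal_univ (fun _ => (0 : ℝ)),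
    lmarginal_erase' F hF (Finset.mem_univ l), lmarginal_erase' G hG (Finset.mem_univ l), hFG]

/-- The cell `[0,L)³ ⊂ ℝ³` is the cube `∏ [0,L)` pulled back along the chart `toLp`. [folklore] -/
theorem toLp_preimage_cell (L : ℝ) :
    (WithLp.toLp 2 : (Fin 3 → ℝ) → Space) ⁻¹' cell L = Set.univ.pi fun _ => Set.Ico 0 L := by
  ext y
  simp [cell]

/-- **Tonelli along one axis of the cell.** Two measurable functions on `ℝ³` whose line integrals
over `[0,L)` along the axis `l` agree on every line (in the chart `y = toLp z`, the line through
`toLp z` is `t ↦ toLp (z[l ↦ t])`) have the same integral over the cell `[0,L)³` (volume-preserving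
chart `PiLp.volume_preserving_toLp`, `Measure.restrict_pi_pi`, and
`lintegral_pi_eq_of_lintegral_update_eq`). [folklore] -/
theorem setLIntegral_cell_eq_of_line (L : ℝ) (l : Fin 3) {Φ Ψ : Space → ℝ≥0∞} (hΦ : Measurable Φ)
    (hΨ : Measurable Ψ)
    (h : ∀ z : Fin 3 → ℝ,
      ∫⁻ t in Set.Ico 0 L, Φ (WithLp.toLp 2 (Function.update z l t)) =
        ∫⁻ t in Set.Ico 0 L, Ψ (WithLp.toLp 2 (Function.update z l t))) :
    ∫⁻ y in cell L, Φ y = ∫⁻ y in cell L, Ψ y := by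
  have hmp := PiLp.volume_preserving_toLp (Fin 3)
  have hme : MeasurableEmbedding (WithLp.toLp 2 : (Fin 3 → ℝ) → Space) :=
    (MeasurableEquiv.toLp 2 (Fin 3 → ℝ)).measurableEmbedding
  rw [← hmp.setLIntegral_comp_preimage_emb hme Φ, ← hmp.setLIntegral_comp_preimage_emb hme Ψ,
    toLp_preimage_cell, volume_pi, Measure.restrict_pi_pi]
  exact lintegral_pi_eq_of_lintegral_update_eq l (hΦ.comp (WithLp.measurable_toLp 2 _))
    (hΨ.comp (WithLp.measurable_toLp 2 _)) h

/-! ### The fibre lines in the chart -/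

/-- `toLp (z[l ↦ s]) = toLp z + (s − z_l) e_l` in `ℝ³`. [folklore] -/
theorem toLp_update_eq (l : Fin 3) (z : Fin 3 → ℝ) (s : ℝ) :
    (WithLp.toLp 2 (Function.update z l s) : Space) =
      WithLp.toLp 2 z + (s - z l) • EuclideanSpace.single l (1 : ℝ) := by
  ext k
  by_cases hk : k = l
  · subst hk
    simp
  · simp [hk]

/-- The fibre line along the axis `l` through `X[0 ↦ toLp z]` is `s ↦ X[0 ↦ toLp (z[l ↦ s])]`:
`linePt l (X[0 ↦ toLp z]) s = X[0 ↦ toLp (z[l ↦ s])]` (`update_zero_add`). [folklore] -/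
theorem linePt_update_toLp (l : Fin 3) (X : Config (m + 1)) (z : Fin 3 → ℝ) (s : ℝ) :
    linePt l (Function.update X 0 (WithLp.toLp 2 z : Space)) s =
      Function.update X 0 (WithLp.toLp 2 (Function.update z l s)) := by
  rw [toLp_update_eq, update_zero_add, linePt, Function.update_self, fibreDir, ← Pi.single_smul]

/-- The line average in the chart: at `X[0 ↦ toLp (z[l ↦ t])]` it is
`L⁻¹ ∫₀ᴸ f (X[0 ↦ toLp (z[l ↦ s])]) ds`, independent of `t`. [folklore] -/
theorem lineAvg_update_toLp (L : ℝ) (l : Fin 3) (f : Config (m + 1) → ℝ) (X : Config (m + 1))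
    (z : Fin 3 → ℝ) (t : ℝ) :
    lineAvg L l f (Function.update X 0 (WithLp.toLp 2 (Function.update z l t))) =
      L⁻¹ * ∫ s in (0 : ℝ)..L, f (Function.update X 0 (WithLp.toLp 2 (Function.update z l s))) := by
  simp only [lineAvg, linePt_update_toLp, Function.update_idem]

/-- Line averages of continuous functions are continuous (parametric interval integral of a jointly
continuous integrand, `intervalIntegral.continuous_parametric_intervalIntegral_of_continuous'`).
[folklore] -/
theorem continuous_lineAvg_of_continuous (L : ℝ) (l : Fin 3) {f : Config (m + 1) → ℝ}
    (hf : Continuous f) : Continuous (lineAvg L l f) := by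
  have h : Continuous (Function.uncurry fun (X : Config (m + 1)) (t : ℝ) => f (linePt l X t)) :=
    hf.comp ((contDiff_linePt (m := m) l (n := 0)).continuous.comp continuous_swap)
  exact continuous_const.mul
    (intervalIntegral.continuous_parametric_intervalIntegral_of_continuous' h 0 L)

/-! ### `LineFubini` -/

/-- **Line Fubini on the fibre cell** (the statement `LineFubini`, gen 1's
`lintegral_cell_ofReal_lineAvg`). For continuous `f ≥ 0`, every axis `l` and every `X`,
`∫_cell ⟨f⟩_l(X[0↦y]) dy = ∫_cell f(X[0↦y]) dy`: by `setLIntegral_cell_eq_of_line` it suffices that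
on every line both line integrals over `[0,L)` equal `ofReal (∫₀ᴸ f(X[0 ↦ toLp (z[l ↦ s])]) ds)` —
the left because its integrand is the constant `L⁻¹ ×` that integral (`lineAvg_update_toLp`,
`|[0,L)| = L`), the right by `ofReal_integral_eq_lintegral_ofReal`. (Folland, *Real Analysis*,
Thm. 2.37.) [folklore] -/
theorem lintegral_cell_ofReal_lineAvg (hL : 0 < L) (l : Fin 3) {f : Config (m + 1) → ℝ}
    (hf : Continuous f) (hf0 : ∀ Y, 0 ≤ f Y) (X : Config (m + 1)) :
    ∫⁻ y in cell L, ENNReal.ofReal (lineAvg L l f (Function.update X 0 y)) =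
      ∫⁻ y in cell L, ENNReal.ofReal (f (Function.update X 0 y)) := by
  have hupd : Continuous fun y : Space => Function.update X 0 y :=
    continuous_const.update 0 continuous_id
  have hΦ : Measurable fun y : Space => ENNReal.ofReal (lineAvg L l f (Function.update X 0 y)) :=
    ENNReal.measurable_ofReal.comp ((continuous_lineAvg_of_continuous L l hf).comp hupd).measurable
  have hΨ : Measurable fun y : Space => ENNReal.ofReal (f (Function.update X 0 y)) :=
    ENNReal.measurable_ofReal.comp (hf.comp hupd).measurable
  refine setLIntegral_cell_eq_of_line L l hΦ hΨ fun z => ?_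
  -- the line integrand in the chart
  set φ : ℝ → ℝ := fun s => f (Function.update X 0 (WithLp.toLp 2 (Function.update z l s))) with hφ
  have hφc : Continuous φ := by
    have : φ = fun s => f (linePt l (Function.update X 0 (WithLp.toLp 2 z : Space)) s) := by
      funext s
      rw [hφ, linePt_update_toLp]
    rw [this]
    exact hf.comp (continuous_linePt l _)
  have hφ0 : ∀ s, 0 ≤ φ s := fun s => hf0 _
  calc ∫⁻ t in Set.Ico 0 L, ENNReal.ofReal
          (lineAvg L l f (Function.update X 0 (WithLp.toLp 2 (Function.update z l t))))
      = ∫⁻ _ in Set.Ico 0 L, ENNReal.ofReal (L⁻¹ * ∫ s in (0 : ℝ)..L, φ s) := by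
        simp only [lineAvg_update_toLp, hφ]
    _ = ENNReal.ofReal (∫ s in (0 : ℝ)..L, φ s) := by
        rw [setLIntegral_const, Real.volume_Ico, sub_zero, mul_comm, ← ENNReal.ofReal_mul hL.le,
          ← mul_assoc, mul_inv_cancel₀ hL.ne', one_mul]
    _ = ∫⁻ s in Set.Ioc 0 L, ENNReal.ofReal (φ s) := by
        rw [intervalIntegral.integral_of_le hL.le]
        exact ofReal_integral_eq_lintegral_ofReal hφc.integrableOn_Ioc
          (Filter.Eventually.of_forall hφ0)
    _ = ∫⁻ s in Set.Ico 0 L, ENNReal.ofReal (φ s) := (setLIntegral_congr Ico_ae_eq_Ioc).symm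

/-- **`LineFubini` holds.** [folklore] -/
theorem lineFubini : LineFubini :=
  fun _m _L hL l _f hf hf0 X => lintegral_cell_ofReal_lineAvg hL l hf hf0 X

/-! ### `Avg3Const`: the triple line average of `g` is `≡ 1` -/

/-- `c e₀⊗e_k` has vanishing `(0,l)` coordinate for `l ≠ k`. [folklore] -/
theorem smul_fibreDir_apply_zero_of_ne (c : ℝ) {k l : Fin 3} (h : l ≠ k) :
    (c • (fibreDir k : Config (m + 1))) 0 l = 0 := by
  simp [fibreDir, h]

/-- `⟨⟨g⟩₂⟩₁` is constant along the axis `2` of particle `0` (inherited from `⟨g⟩₂`, which is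
constant along its own line). [folklore] -/
theorem gAvg2_add_smul_fibreDir_two (L : ℝ) (Φ : PeriodicTrialState (m + 1) L) (X : Config (m + 1))
    (c : ℝ) : gAvg2 L Φ (X + c • fibreDir 2) = gAvg2 L Φ X :=
  lineAvg_add_of_apply_eq_zero L 1 (smul_fibreDir_apply_zero_of_ne c (by decide))
    (fun Y => lineAvg_add_smul L 2 (gDens L Φ) Y c) X

/-- `⟨⟨⟨g⟩₂⟩₁⟩₀` is constant along all three axes of particle `0`: along its own axis `0`
(`lineAvg_add_smul`), and along the axes `1`, `2` because its integrand `⟨⟨g⟩₂⟩₁` is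
(`lineAvg_add_of_apply_eq_zero`). [folklore] -/
theorem gAvg3_add_smul_fibreDir (L : ℝ) (Φ : PeriodicTrialState (m + 1) L) (X : Config (m + 1))
    (c : ℝ) (k : Fin 3) : gAvg3 L Φ (X + c • fibreDir k) = gAvg3 L Φ X := by
  fin_cases k
  · exact lineAvg_add_smul L 0 (gAvg2 L Φ) X c
  · exact lineAvg_add_of_apply_eq_zero L 0 (smul_fibreDir_apply_zero_of_ne c (by decide))
      (fun Y => lineAvg_add_smul L 1 (gAvg1 L Φ) Y c) X
  · exact lineAvg_add_of_apply_eq_zero L 0 (smul_fibreDir_apply_zero_of_ne c (by decide))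
      (fun Y => gAvg2_add_smul_fibreDir_two L Φ Y c) X

/-- `X[0 ↦ y]` is a translate of `X` along the three axes of particle `0`. [folklore] -/
theorem update_eq_add_smul_fibreDir (X : Config (m + 1)) (y : Space) :
    Function.update X 0 y = X + (y 0 - X 0 0) • fibreDir 0 + (y 1 - X 0 1) • fibreDir 1 +
      (y 2 - X 0 2) • fibreDir 2 := by
  funext j
  rcases eq_or_ne j 0 with rfl | hj
  · simp only [Function.update_self, Pi.add_apply, Pi.smul_apply, fibreDir, Pi.single_eq_same]
    ext k
    fin_cases k <;> simp
  · simp [hj, fibreDir]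

/-- `⟨⟨⟨g⟩₂⟩₁⟩₀` is constant on every fibre: `⟨⟨⟨g⟩⟩⟩(X[0 ↦ y]) = ⟨⟨⟨g⟩⟩⟩(X)`. [folklore] -/
theorem gAvg3_update (L : ℝ) (Φ : PeriodicTrialState (m + 1) L) (X : Config (m + 1)) (y : Space) :
    gAvg3 L Φ (Function.update X 0 y) = gAvg3 L Φ X := by
  rw [update_eq_add_smul_fibreDir, gAvg3_add_smul_fibreDir, gAvg3_add_smul_fibreDir,
    gAvg3_add_smul_fibreDir]

/-- `g = L³ψ² ≥ 0` (`L ≥ 0`). [folklore] -/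
theorem gDens_nonneg (hL : 0 ≤ L) (Φ : PeriodicTrialState (m + 1) L) (X : Config (m + 1)) :
    0 ≤ gDens L Φ X :=
  mul_nonneg (pow_nonneg hL 3) (sq_nonneg _)

/-- `⟨g⟩₂ ≥ 0`. [folklore] -/
theorem gAvg1_nonneg (hL : 0 ≤ L) (Φ : PeriodicTrialState (m + 1) L) (X : Config (m + 1)) :
    0 ≤ gAvg1 L Φ X :=
  lineAvg_nonneg hL 2 (gDens_nonneg hL Φ) X

/-- `⟨⟨g⟩₂⟩₁ ≥ 0`. [folklore] -/
theorem gAvg2_nonneg (hL : 0 ≤ L) (Φ : PeriodicTrialState (m + 1) L) (X : Config (m + 1)) :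
    0 ≤ gAvg2 L Φ X :=
  lineAvg_nonneg hL 1 (gAvg1_nonneg hL Φ) X

/-- `⟨⟨⟨g⟩₂⟩₁⟩₀ ≥ 0`. [folklore] -/
theorem gAvg3_nonneg (hL : 0 ≤ L) (Φ : PeriodicTrialState (m + 1) L) (X : Config (m + 1)) :
    0 ≤ gAvg3 L Φ X :=
  lineAvg_nonneg hL 0 (gAvg2_nonneg hL Φ) X

/-- `∫_cell g(X[0 ↦ y]) dy = L³`: the conditional law is normalised on every fibre
(`integral_fibrePsi_sq`). [folklore] -/
theorem lintegral_cell_ofReal_gDens (hL : 0 < L) (Φ : PeriodicTrialState (m + 1) L)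
    (hΦ : ∀ X, Φ.ψ X ≠ 0) (X : Config (m + 1)) :
    ∫⁻ y in cell L, ENNReal.ofReal (gDens L Φ (Function.update X 0 y)) = ENNReal.ofReal (L ^ 3) := by
  have hc : Continuous fun y : Space => gDens L Φ (Function.update X 0 y) :=
    (contDiff_gDens hL Φ hΦ).continuous.comp (continuous_const.update 0 continuous_id)
  rw [← ofReal_integral_eq_lintegral_ofReal (integrableOn_cell hc)
    (Filter.Eventually.of_forall fun y => gDens_nonneg hL.le Φ _)]
  congr 1
  simp only [gDens]
  rw [integral_const_mul, integral_fibrePsi_sq hL Φ hΦ X, mul_one]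

/-- **`⟨⟨⟨g⟩₂⟩₁⟩₀ ≡ 1`** (the statement `Avg3Const`) for a zero-free state, `L > 0`:
`L³·⟨⟨⟨g⟩⟩⟩(X) = ∫_cell ⟨⟨⟨g⟩⟩⟩(X[0↦y]) dy` (`gAvg3_update`) `= ∫_cell ⟨⟨g⟩⟩ = ∫_cell ⟨g⟩ = ∫_cell g`
(`LineFubini` along the axes `0, 1, 2`) `= L³` (`lintegral_cell_ofReal_gDens`), and `L³ ≠ 0, ∞`
cancels. (Folland, *Real Analysis*, Thm. 2.37.) [folklore] -/
theorem gAvg3_eq_one (hL : 0 < L) (Φ : PeriodicTrialState (m + 1) L) (hΦ : ∀ X, Φ.ψ X ≠ 0)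
    (X : Config (m + 1)) : gAvg3 L Φ X = 1 := by
  have hkey : ENNReal.ofReal L ^ 3 * ENNReal.ofReal (gAvg3 L Φ X) = ENNReal.ofReal L ^ 3 * 1 := by
    calc ENNReal.ofReal L ^ 3 * ENNReal.ofReal (gAvg3 L Φ X)
        = ∫⁻ y in cell L, ENNReal.ofReal (gAvg3 L Φ (Function.update X 0 y)) := by
          simp only [gAvg3_update]
          rw [setLIntegral_const, volume_cell, mul_comm]
      _ = ∫⁻ y in cell L, ENNReal.ofReal (gAvg2 L Φ (Function.update X 0 y)) :=
          lintegral_cell_ofReal_lineAvg hL 0 (contDiff_gAvg2 hL Φ hΦ).continuous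
            (gAvg2_nonneg hL.le Φ) X
      _ = ∫⁻ y in cell L, ENNReal.ofReal (gAvg1 L Φ (Function.update X 0 y)) :=
          lintegral_cell_ofReal_lineAvg hL 1 (contDiff_gAvg1 hL Φ hΦ).continuous
            (gAvg1_nonneg hL.le Φ) X
      _ = ∫⁻ y in cell L, ENNReal.ofReal (gDens L Φ (Function.update X 0 y)) :=
          lintegral_cell_ofReal_lineAvg hL 2 (contDiff_gDens hL Φ hΦ).continuous
            (gDens_nonneg hL.le Φ) X
      _ = ENNReal.ofReal L ^ 3 * 1 := by
          rw [lintegral_cell_ofReal_gDens hL Φ hΦ X, ENNReal.ofReal_pow hL.le, mul_one]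
  have h0 : ENNReal.ofReal L ^ 3 ≠ 0 :=
    pow_ne_zero _ (by rwa [Ne, ENNReal.ofReal_eq_zero, not_le])
  have ht : ENNReal.ofReal L ^ 3 ≠ ⊤ := ENNReal.pow_ne_top ENNReal.ofReal_ne_top
  exact ENNReal.ofReal_eq_one.1 ((ENNReal.mul_right_inj h0 ht).1 hkey)

/-- **`Avg3Const` holds.** [folklore] -/
theorem avg3Const : Avg3Const :=
  fun _m _L hL Φ hΦ X => gAvg3_eq_one hL Φ hΦ X

/-! ### The registered stub -/

/-- **Registered stub `stub_lineFubini`** of the line `parseval-shell-bootstrap` (r4): the line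
Fubini identity on the fibre cell and the constancy `⟨⟨⟨g⟩₂⟩₁⟩₀ ≡ 1`
(statement `Goal.stub_lineFubini = LineFubini ∧ Avg3Const`). [folklore] -/
theorem stub_lineFubini : Goal.stub_lineFubini :=
  ⟨lineFubini, avg3Const⟩

end Summit.AtomisticToContinuum.BoseEinsteinCondensation.Cruxes.FibreConductance.ParsevalShellBootstrap

end
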